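import Mathlib
import Summits.ValiantsHypothesis.ValiantsHypothesis.Theorems.LacunarySymmetroidMatrixDescartesInertiaJump
import Summits.ValiantsHypothesis.ValiantsHypothesis.Theorems.LacunarySymmetroidMatrixDescartesDetMultiplicityJordanChain

/-!
# `MatrixDescartes` (stmt-ValiantsHypothesis-18050) — INERTIA KIT, III-c: THE SIGNATURE LAW FOR LACUNARY SYMMETRIC PENCILS and
# THE DEFINITE-TYPE JUMP LAW — at a root `x₀` of NEGATIVE TYPE (every kernel vector's Rayleigh polynomial decreasing through
# `x₀`) the negative index of `F(x) = ∑ₖ x^{dₖ}Sₖ` climbs by EXACTLY `dim ker F(x₀) = mult_{x₀} det F`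

HONEST FRAMING.  Cell `pub-symmetroid`, seat `val-sym-mdr-p2` (gen 17); helper file `--supports` the crux
`Theses.LacunarySymmetroid.MatrixDescartes`, NO closure claim.  Valid for EVERY real symmetric lacunary pencil at EVERY format
(any exponents `d : κ → ℕ`, any real symmetric letters); a local structure theorem at the roots of `det F`, not a root bound.
Nothing here bears on the crux in its window, on `stub_twoSided`, on `DoorA26`/`DoorA34`, registers, or `VP ≠ VNP`.

CONTENT.  `exists_pencil_firstOrder`: the first-order expansion `F(x) = F(x₀) + (x − x₀)·G(x)` with the polynomial
difference-quotient family `G(x) = ∑ₖ (∑_{i<dₖ} xⁱx₀^{dₖ−1−i}) Sₖ` and `G(x₀) = F′(x₀) = ∑ₖ dₖx₀^{dₖ−1}Sₖ` (`Commute.geom_sum₂_mul`);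
`exists_kernel_basis` / `comb_kernel`: `corank`-many independent kernel vectors.  `pencil_indices_eq_right/left`: THE SIGNATURE LAW
in pencil currency — kernel families `n⁻`, `n⁺` of `F(x₀)` on whose combinations the kernel form `vᵀF′(x₀)v` (`= P_v′(x₀)`, tree
`Multiplicity.form_derivative_eq_eval`) is negative / positive, `card n⁻ + card n⁺ = dim ker F(x₀)` ⇒ right of `x₀`:
`ν = ν(F(x₀)) + card n⁻`, `π = π(F(x₀)) + card n⁺`; left: the mirror.  `pencil_indices_eq_of_negType` / `_of_posType`: THE
DEFINITE-TYPE JUMP LAW — if every non-zero kernel vector `u` has `P_u′(x₀) < 0` then `ν` climbs by EXACTLY `dim ker F(x₀)` across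
`x₀` while `π` is continuous there (positive type mirrors); `pencil_negIndex_jump_eq_rootMultiplicity_of_negType`: for
`a < x₀ < b` near `x₀`, `ν(F(b)) = ν(F(a)) + mult_{x₀} det F` (the tree's first-order multiplicity law
`Multiplicity.rootMultiplicity_det_pencil_eq_corank` converts `dim ker` into multiplicity).  Reading: the INERTIA-WALK
CERTIFICATE of `…InertiaCertificate` (`Σ|Δν| ≤ #roots with multiplicity`) is an EQUALITY across every root of definite type,
and across a root of mixed type `(p, q)` it undercounts by exactly `2·min(p, q)`.  Semisimple case of
[GohbergLancasterRodman2005, Thm 12.5.2]. [folklore]; axioms standard; no definitions.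
-/

-- layout Summits/ValiantsHypothesis/ValiantsHypothesis forces the duplicated namespace component
set_option linter.dupNamespace false

namespace Summit.ValiantsHypothesis.ValiantsHypothesis.Theorems.LacunarySymmetroidMatrixDescartes

open Matrix Finset
open scoped BigOperators Topology

namespace Inertia

variable {ι : Type} [Fintype ι] [DecidableEq ι]

/-! ## §4 Lacunary symmetric pencils: first-order expansion, kernel bases, and the definite-type jump law -/

section Pencil

variable {κ : Type} [Fintype κ]

omit [Fintype ι] [DecidableEq ι] in
/-- **First-order expansion of a lacunary pencil.**  `F(x) = ∑ₖ x^{dₖ}Sₖ = F(x₀) + (x − x₀)·G(x)` with the polynomial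
difference-quotient family `G(x) = ∑ₖ (∑_{i<dₖ} xⁱ x₀^{dₖ−1−i}) Sₖ`, entrywise continuous, `G(x₀) = F′(x₀) = ∑ₖ dₖx₀^{dₖ−1}Sₖ`.
[folklore] -/
theorem exists_pencil_firstOrder (d : κ → ℕ) (S : κ → Matrix ι ι ℝ) (x₀ : ℝ) :
    ∃ G : ℝ → Matrix ι ι ℝ, (∀ i j, Continuous fun x => G x i j) ∧
      (∀ x, (∑ k, x ^ d k • S k) = (∑ k, x₀ ^ d k • S k) + (x - x₀) • G x) ∧
      G x₀ = ∑ k, ((d k : ℝ) * x₀ ^ (d k - 1)) • S k := by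
  refine ⟨fun x => ∑ k, (∑ i ∈ Finset.range (d k), x ^ i * x₀ ^ (d k - 1 - i)) • S k, ?_, ?_, ?_⟩
  · intro a b
    have h : (fun x : ℝ => (∑ k, (∑ i ∈ Finset.range (d k), x ^ i * x₀ ^ (d k - 1 - i)) • S k) a b)
        = fun x => ∑ k, (∑ i ∈ Finset.range (d k), x ^ i * x₀ ^ (d k - 1 - i)) * S k a b := by
      funext x; simp [Matrix.sum_apply, Matrix.smul_apply, smul_eq_mul]
    rw [h]
    refine continuous_finsetSum _ fun k _ => Continuous.mul ?_ continuous_const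
    exact continuous_finsetSum _ fun i _ => (continuous_pow i).mul continuous_const
  · intro x
    rw [Finset.smul_sum, ← Finset.sum_add_distrib]
    refine Finset.sum_congr rfl fun k _ => ?_
    rw [smul_smul, ← add_smul]
    congr 1
    have h := (Commute.all x x₀).geom_sum₂_mul (d k)
    -- `(∑ xⁱx₀^{d-1-i})·(x − x₀) = x^d − x₀^d`
    linear_combination -h
  · refine Finset.sum_congr rfl fun k _ => ?_
    congr 1
    have h : ∀ i ∈ Finset.range (d k), x₀ ^ i * x₀ ^ (d k - 1 - i) = x₀ ^ (d k - 1) := by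
      intro i hi
      rw [← pow_add]
      congr 1
      have := Finset.mem_range.1 hi
      omega
    rw [Finset.sum_congr rfl h, Finset.sum_const, Finset.card_range, nsmul_eq_mul]

omit [DecidableEq ι] in
/-- **Kernel basis.**  Every real square matrix has `corank`-many linearly independent kernel vectors:
`∃ k, n : Fin k → ℝ^ι` independent with `A nⱼ = 0` and `rank A + k = card ι`. [folklore] -/
theorem exists_kernel_basis (A : Matrix ι ι ℝ) :
    ∃ (k : ℕ) (n : Fin k → ι → ℝ), LinearIndependent ℝ n ∧ (∀ j, A *ᵥ n j = 0) ∧ A.rank + k = Fintype.card ι := by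
  let W : Submodule ℝ (ι → ℝ) := LinearMap.ker A.mulVecLin
  let b : Module.Basis (Fin (Module.finrank ℝ W)) ℝ W := Module.finBasis ℝ W
  refine ⟨Module.finrank ℝ W, fun j => (b j : ι → ℝ), b.linearIndependent.map' W.subtype (Submodule.ker_subtype W),
    ?_, ?_⟩
  · intro j
    have hmem : (b j : ι → ℝ) ∈ W := (b j).2
    have h2 := LinearMap.mem_ker.1 hmem
    rwa [Matrix.mulVecLin_apply] at h2
  · have h1 := LinearMap.finrank_range_add_finrank_ker A.mulVecLin
    rw [Module.finrank_fintype_fun_eq_card] at h1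
    have h2 : A.rank = Module.finrank ℝ (LinearMap.range A.mulVecLin) := rfl
    rw [h2]
    exact h1

omit [DecidableEq ι] in
/-- A non-trivial combination of an independent kernel family is a non-zero kernel vector. [folklore] -/
theorem comb_kernel {k : ℕ} (A : Matrix ι ι ℝ) (n : Fin k → ι → ℝ) (hli : LinearIndependent ℝ n)
    (hker : ∀ j, A *ᵥ n j = 0) (c : Fin k → ℝ) (hc : c ≠ 0) :
    A *ᵥ (∑ j, c j • n j) = 0 ∧ (∑ j, c j • n j) ≠ 0 := by
  refine ⟨?_, ?_⟩
  · rw [Matrix.mulVec_sum]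
    exact Finset.sum_eq_zero fun j _ => by rw [Matrix.mulVec_smul, hker, smul_zero]
  · intro h0
    apply hc
    funext j
    exact Fintype.linearIndependent_iff.1 hli c h0 j

/-- **THE SIGNATURE LAW FOR LACUNARY SYMMETRIC PENCILS, right side.**  `F(X) = ∑ₖ X^{dₖ}Sₖ` with real symmetric letters,
`x₀ : ℝ`, kernel families `n⁻ : β → ker F(x₀)` on whose combinations the kernel form `vᵀF′(x₀)v` (`F′(x₀) = ∑ₖ dₖx₀^{dₖ−1}Sₖ`)
is negative and `n⁺ : γ → ker F(x₀)` on whose combinations it is positive, `card β + card γ = dim ker F(x₀)`.  Then for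
`x > x₀` near `x₀`: `ν(F(x)) = ν(F(x₀)) + card β`, `π(F(x)) = π(F(x₀)) + card γ`, `F(x)` non-singular. [folklore] -/
theorem pencil_indices_eq_right {β γ : Type} [Fintype β] [Fintype γ] (d : κ → ℕ) (S : κ → Matrix ι ι ℝ)
    (hS : ∀ k, (S k).IsSymm) (x₀ : ℝ) (nm : β → ι → ℝ) (np : γ → ι → ℝ)
    (hnm0 : ∀ j, (∑ k, x₀ ^ d k • S k) *ᵥ nm j = 0) (hnp0 : ∀ j, (∑ k, x₀ ^ d k • S k) *ᵥ np j = 0)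
    (hnm : ∀ c : β → ℝ, c ≠ 0 →
      (∑ j, c j • nm j) ⬝ᵥ ((∑ k, ((d k : ℝ) * x₀ ^ (d k - 1)) • S k) *ᵥ ∑ j, c j • nm j) < 0)
    (hnp : ∀ c : γ → ℝ, c ≠ 0 →
      0 < (∑ j, c j • np j) ⬝ᵥ ((∑ k, ((d k : ℝ) * x₀ ^ (d k - 1)) • S k) *ᵥ ∑ j, c j • np j))
    (hcard : Fintype.card β + Fintype.card γ = Fintype.card ι - (∑ k, x₀ ^ d k • S k).rank) :
    ∀ᶠ x in 𝓝[>] x₀,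
      Fintype.card {j // (isHermitian_pencil d S hS x).eigenvalues j < 0}
          = Fintype.card {j // (isHermitian_pencil d S hS x₀).eigenvalues j < 0} + Fintype.card β ∧
      Fintype.card {j // 0 < (isHermitian_pencil d S hS x).eigenvalues j}
          = Fintype.card {j // 0 < (isHermitian_pencil d S hS x₀).eigenvalues j} + Fintype.card γ ∧
      Fintype.card ι - (∑ k, x ^ d k • S k).rank = 0 := by
  obtain ⟨G, hG, hFG, hG0⟩ := exists_pencil_firstOrder d S x₀
  rw [← hG0] at hnm hnp
  exact eventually_indices_eq_right (fun x => ∑ k, x ^ d k • S k) G x₀ hG hFG (isHermitian_pencil d S hS) nm np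
    hnm0 hnp0 hnm hnp hcard

/-- **THE SIGNATURE LAW FOR LACUNARY SYMMETRIC PENCILS, left side**: for `x < x₀` near `x₀`,
`ν(F(x)) = ν(F(x₀)) + card γ`, `π(F(x)) = π(F(x₀)) + card β`, `F(x)` non-singular. [folklore] -/
theorem pencil_indices_eq_left {β γ : Type} [Fintype β] [Fintype γ] (d : κ → ℕ) (S : κ → Matrix ι ι ℝ)
    (hS : ∀ k, (S k).IsSymm) (x₀ : ℝ) (nm : β → ι → ℝ) (np : γ → ι → ℝ)
    (hnm0 : ∀ j, (∑ k, x₀ ^ d k • S k) *ᵥ nm j = 0) (hnp0 : ∀ j, (∑ k, x₀ ^ d k • S k) *ᵥ np j = 0)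
    (hnm : ∀ c : β → ℝ, c ≠ 0 →
      (∑ j, c j • nm j) ⬝ᵥ ((∑ k, ((d k : ℝ) * x₀ ^ (d k - 1)) • S k) *ᵥ ∑ j, c j • nm j) < 0)
    (hnp : ∀ c : γ → ℝ, c ≠ 0 →
      0 < (∑ j, c j • np j) ⬝ᵥ ((∑ k, ((d k : ℝ) * x₀ ^ (d k - 1)) • S k) *ᵥ ∑ j, c j • np j))
    (hcard : Fintype.card β + Fintype.card γ = Fintype.card ι - (∑ k, x₀ ^ d k • S k).rank) :
    ∀ᶠ x in 𝓝[<] x₀,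
      Fintype.card {j // (isHermitian_pencil d S hS x).eigenvalues j < 0}
          = Fintype.card {j // (isHermitian_pencil d S hS x₀).eigenvalues j < 0} + Fintype.card γ ∧
      Fintype.card {j // 0 < (isHermitian_pencil d S hS x).eigenvalues j}
          = Fintype.card {j // 0 < (isHermitian_pencil d S hS x₀).eigenvalues j} + Fintype.card β ∧
      Fintype.card ι - (∑ k, x ^ d k • S k).rank = 0 := by
  obtain ⟨G, hG, hFG, hG0⟩ := exists_pencil_firstOrder d S x₀
  rw [← hG0] at hnm hnp
  exact eventually_indices_eq_left (fun x => ∑ k, x ^ d k • S k) G x₀ hG hFG (isHermitian_pencil d S hS) nm np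
    hnm0 hnp0 hnm hnp hcard

/-- **THE DEFINITE-TYPE JUMP LAW (negative type).**  `F(X) = ∑ₖ X^{dₖ}Sₖ` with real symmetric letters.  If every non-zero
kernel vector `u` of `F(x₀)` has `P_u′(x₀) < 0` for its Rayleigh polynomial `P_u = ∑ₖ (uᵀSₖu)X^{dₖ}` (the root `x₀` is of
NEGATIVE TYPE), then across `x₀` the negative index climbs by EXACTLY `dim ker F(x₀)` and the positive index is continuous:
for `x > x₀` near `x₀`, `ν(F(x)) = ν(F(x₀)) + dim ker F(x₀)` and `π(F(x)) = π(F(x₀))`; for `x < x₀` near `x₀`,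
`ν(F(x)) = ν(F(x₀))` and `π(F(x)) = π(F(x₀)) + dim ker F(x₀)`. [folklore] -/
theorem pencil_indices_eq_of_negType (d : κ → ℕ) (S : κ → Matrix ι ι ℝ) (hS : ∀ k, (S k).IsSymm) (x₀ : ℝ)
    (hneg : ∀ u : ι → ℝ, (∑ k, x₀ ^ d k • S k) *ᵥ u = 0 → u ≠ 0 →
      (Polynomial.derivative (∑ k, Polynomial.C (u ⬝ᵥ (S k *ᵥ u)) * (Polynomial.X : Polynomial ℝ) ^ d k)).eval x₀ < 0) :
    (∀ᶠ x in 𝓝[>] x₀,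
      Fintype.card {j // (isHermitian_pencil d S hS x).eigenvalues j < 0}
          = Fintype.card {j // (isHermitian_pencil d S hS x₀).eigenvalues j < 0}
            + (Fintype.card ι - (∑ k, x₀ ^ d k • S k).rank) ∧
      Fintype.card {j // 0 < (isHermitian_pencil d S hS x).eigenvalues j}
          = Fintype.card {j // 0 < (isHermitian_pencil d S hS x₀).eigenvalues j} ∧
      Fintype.card ι - (∑ k, x ^ d k • S k).rank = 0) ∧
    (∀ᶠ x in 𝓝[<] x₀,
      Fintype.card {j // (isHermitian_pencil d S hS x).eigenvalues j < 0}
          = Fintype.card {j // (isHermitian_pencil d S hS x₀).eigenvalues j < 0} ∧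
      Fintype.card {j // 0 < (isHermitian_pencil d S hS x).eigenvalues j}
          = Fintype.card {j // 0 < (isHermitian_pencil d S hS x₀).eigenvalues j}
            + (Fintype.card ι - (∑ k, x₀ ^ d k • S k).rank) ∧
      Fintype.card ι - (∑ k, x ^ d k • S k).rank = 0) := by
  obtain ⟨k, n, hli, hker, hrank⟩ := exists_kernel_basis (∑ k, x₀ ^ d k • S k)
  have hnm : ∀ c : Fin k → ℝ, c ≠ 0 →
      (∑ j, c j • n j) ⬝ᵥ ((∑ k, ((d k : ℝ) * x₀ ^ (d k - 1)) • S k) *ᵥ ∑ j, c j • n j) < 0 := by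
    intro c hc
    obtain ⟨hu, hu0⟩ := comb_kernel _ n hli hker c hc
    rw [Multiplicity.form_derivative_eq_eval]
    exact hneg _ hu hu0
  have hnp : ∀ c : Fin 0 → ℝ, c ≠ 0 →
      0 < (∑ j, c j • Fin.elim0 j) ⬝ᵥ ((∑ k, ((d k : ℝ) * x₀ ^ (d k - 1)) • S k) *ᵥ ∑ j, c j • Fin.elim0 j) := by
    intro c hc
    exact absurd (funext fun j => Fin.elim0 j) hc
  have hcard : Fintype.card (Fin k) + Fintype.card (Fin 0) = Fintype.card ι - (∑ k, x₀ ^ d k • S k).rank := by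
    simp only [Fintype.card_fin]
    omega
  have hk : Fintype.card ι - (∑ k, x₀ ^ d k • S k).rank = k := by omega
  refine ⟨?_, ?_⟩
  · refine (pencil_indices_eq_right d S hS x₀ n Fin.elim0 hker (fun j => Fin.elim0 j) hnm hnp hcard).mono
      fun x hx => ?_
    simp only [Fintype.card_fin, add_zero] at hx
    rw [hk]
    exact hx
  · refine (pencil_indices_eq_left d S hS x₀ n Fin.elim0 hker (fun j => Fin.elim0 j) hnm hnp hcard).mono
      fun x hx => ?_
    simp only [Fintype.card_fin, add_zero] at hx
    rw [hk]
    exact hx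

/-- **THE DEFINITE-TYPE JUMP LAW (positive type).**  If every non-zero kernel vector `u` of `F(x₀)` has `P_u′(x₀) > 0`, then
for `x > x₀` near `x₀`, `ν(F(x)) = ν(F(x₀))` and `π(F(x)) = π(F(x₀)) + dim ker F(x₀)`; for `x < x₀` near `x₀`,
`ν(F(x)) = ν(F(x₀)) + dim ker F(x₀)` and `π(F(x)) = π(F(x₀))`. [folklore] -/
theorem pencil_indices_eq_of_posType (d : κ → ℕ) (S : κ → Matrix ι ι ℝ) (hS : ∀ k, (S k).IsSymm) (x₀ : ℝ)
    (hpos : ∀ u : ι → ℝ, (∑ k, x₀ ^ d k • S k) *ᵥ u = 0 → u ≠ 0 →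
      0 < (Polynomial.derivative (∑ k, Polynomial.C (u ⬝ᵥ (S k *ᵥ u)) * (Polynomial.X : Polynomial ℝ) ^ d k)).eval x₀) :
    (∀ᶠ x in 𝓝[>] x₀,
      Fintype.card {j // (isHermitian_pencil d S hS x).eigenvalues j < 0}
          = Fintype.card {j // (isHermitian_pencil d S hS x₀).eigenvalues j < 0} ∧
      Fintype.card {j // 0 < (isHermitian_pencil d S hS x).eigenvalues j}
          = Fintype.card {j // 0 < (isHermitian_pencil d S hS x₀).eigenvalues j}
            + (Fintype.card ι - (∑ k, x₀ ^ d k • S k).rank) ∧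
      Fintype.card ι - (∑ k, x ^ d k • S k).rank = 0) ∧
    (∀ᶠ x in 𝓝[<] x₀,
      Fintype.card {j // (isHermitian_pencil d S hS x).eigenvalues j < 0}
          = Fintype.card {j // (isHermitian_pencil d S hS x₀).eigenvalues j < 0}
            + (Fintype.card ι - (∑ k, x₀ ^ d k • S k).rank) ∧
      Fintype.card {j // 0 < (isHermitian_pencil d S hS x).eigenvalues j}
          = Fintype.card {j // 0 < (isHermitian_pencil d S hS x₀).eigenvalues j} ∧
      Fintype.card ι - (∑ k, x ^ d k • S k).rank = 0) := by
  obtain ⟨k, n, hli, hker, hrank⟩ := exists_kernel_basis (∑ k, x₀ ^ d k • S k)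
  have hnp : ∀ c : Fin k → ℝ, c ≠ 0 →
      0 < (∑ j, c j • n j) ⬝ᵥ ((∑ k, ((d k : ℝ) * x₀ ^ (d k - 1)) • S k) *ᵥ ∑ j, c j • n j) := by
    intro c hc
    obtain ⟨hu, hu0⟩ := comb_kernel _ n hli hker c hc
    rw [Multiplicity.form_derivative_eq_eval]
    exact hpos _ hu hu0
  have hnm : ∀ c : Fin 0 → ℝ, c ≠ 0 →
      (∑ j, c j • Fin.elim0 j) ⬝ᵥ ((∑ k, ((d k : ℝ) * x₀ ^ (d k - 1)) • S k) *ᵥ ∑ j, c j • Fin.elim0 j) < 0 := by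
    intro c hc
    exact absurd (funext fun j => Fin.elim0 j) hc
  have hcard : Fintype.card (Fin 0) + Fintype.card (Fin k) = Fintype.card ι - (∑ k, x₀ ^ d k • S k).rank := by
    simp only [Fintype.card_fin]
    omega
  have hk : Fintype.card ι - (∑ k, x₀ ^ d k • S k).rank = k := by omega
  refine ⟨?_, ?_⟩
  · refine (pencil_indices_eq_right d S hS x₀ Fin.elim0 n (fun j => Fin.elim0 j) hker hnm hnp hcard).mono
      fun x hx => ?_
    simp only [Fintype.card_fin, add_zero] at hx
    rw [hk]
    exact hx
  · refine (pencil_indices_eq_left d S hS x₀ Fin.elim0 n (fun j => Fin.elim0 j) hker hnm hnp hcard).mono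
      fun x hx => ?_
    simp only [Fintype.card_fin, add_zero] at hx
    rw [hk]
    exact hx

/-- **Negative type: the jump of `ν` across `x₀` equals the multiplicity of `x₀` as a root of `det F`.**  For all
`a < x₀ < b` close enough to `x₀`: `ν(F(b)) = ν(F(a)) + mult_{x₀} det F` and `π(F(a)) = π(F(b)) + mult_{x₀} det F`
(with `mult = dim ker` by the tree's first-order multiplicity law). [folklore] -/
theorem pencil_negIndex_jump_eq_rootMultiplicity_of_negType (d : κ → ℕ) (S : κ → Matrix ι ι ℝ)
    (hS : ∀ k, (S k).IsSymm) (x₀ : ℝ)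
    (hneg : ∀ u : ι → ℝ, (∑ k, x₀ ^ d k • S k) *ᵥ u = 0 → u ≠ 0 →
      (Polynomial.derivative (∑ k, Polynomial.C (u ⬝ᵥ (S k *ᵥ u)) * (Polynomial.X : Polynomial ℝ) ^ d k)).eval x₀ < 0) :
    ∃ δ > 0, ∀ a b : ℝ, x₀ - δ < a → a < x₀ → x₀ < b → b < x₀ + δ →
      Fintype.card {j // (isHermitian_pencil d S hS b).eigenvalues j < 0}
          = Fintype.card {j // (isHermitian_pencil d S hS a).eigenvalues j < 0}
            + (Matrix.det (∑ k, ((Polynomial.X : Polynomial ℝ) ^ d k) • (S k).map Polynomial.C)).rootMultiplicity x₀ ∧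
      Fintype.card {j // 0 < (isHermitian_pencil d S hS a).eigenvalues j}
          = Fintype.card {j // 0 < (isHermitian_pencil d S hS b).eigenvalues j}
            + (Matrix.det (∑ k, ((Polynomial.X : Polynomial ℝ) ^ d k) • (S k).map Polynomial.C)).rootMultiplicity x₀ := by
  have hmult := (Multiplicity.rootMultiplicity_det_pencil_eq_corank d S hS x₀ (fun u hu hu0 => (hneg u hu hu0).ne)).2
  obtain ⟨hR, hL⟩ := pencil_indices_eq_of_negType d S hS x₀ hneg
  rw [eventually_nhdsWithin_iff, Metric.eventually_nhds_iff] at hR hL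
  obtain ⟨δ₁, hδ₁, h₁⟩ := hR
  obtain ⟨δ₂, hδ₂, h₂⟩ := hL
  refine ⟨min δ₁ δ₂, lt_min hδ₁ hδ₂, fun a b ha hax hxb hb => ?_⟩
  have hb' := h₁ (y := b) (by
    rw [Real.dist_eq, abs_lt]; constructor <;> linarith [min_le_left δ₁ δ₂]) hxb
  have ha' := h₂ (y := a) (by
    rw [Real.dist_eq, abs_lt]; constructor <;> linarith [min_le_right δ₁ δ₂]) hax
  rw [hmult]
  omega

end Pencil

end Inertia

end Summit.ValiantsHypothesis.ValiantsHypothesis.Theorems.LacunarySymmetroidMatrixDescartes
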